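import Summits.Ventures.CertifiedManyBodySolver.Theorems.CovNdNiO2M21ResidualLowUSlab
import Summits.Ventures.CertifiedManyBodySolver.Theorems.CovNdNiO2M21ResidualHighUSlab
import HarnessLib
import HarnessLib.Audit

/-!
# Ventures/CertifiedManyBodySolver — Theorems/CovNdNiO2M21LeafOfBundleNodes.lean — «LEAF CAPSTONE» (captain D21)

HONEST FRAMING: the RUNG LEAF «MOS2-ndnio2-M21» `Observables.NdNiO2M21_StiffnessBoxCeiling` (certified T = 0 uniform-flux stiffness CEILING `≤ 0.4779578 = 0.98 ×` the box
kinematic word on the WHOLE downfolded box `boxNdNiO2E_M21` of the NdNiO₂ parent film, router/BOXES/NdNiO2.md «1BH+3BE», SCREENING-GRADE) **MODULO EXACTLY THE THREE SDP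
CLAIM NODES** of route-Ventures-CovNdNiO2M21's rows of record — the route's DECIDING theorem `Theses.CovNdNiO2M21.closes` (planner; Assembly p614307) composed with this seat's
two conditional closers `covNdNiO2M21_ResidualLowUSlab_of_bundleNodes_AF` (p658453) and `covNdNiO2M21_ResidualHighUSlab_of_bundleNodes_AF` (p658251). Nothing is «proved»
unconditionally: the three hypotheses are `@[conjecture]` claim nodes of boxdual pinned-pair reads (segment A e0 read kit j314087 — node p657602; segment B e1 read j313367 — p656818;
segment C e1 read j313498 — p658147), each keyed at hubbard-cov-ndnio2-unc-1's NODE-FREE station-5 chord cap (p628541), so NO #396 and NO VARBOX-LITE plane hypothesis enters;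
the `Q = −X₀(−11/25)` rows are the kinematic theorem `Downfold.ndM21_QRowWN_kinematic` (p636407); the rest of the box is node-free kinematics (box-2 p607598). CONTROL / CALIBRATION
class (xx1) + labelled heuristic; a ceiling never speaks to the presence or absence of superconductivity; not a `T_c` or phase-diagram statement; never «certified true negative /
positive»; no summit statement is proved here (Ventures has none; this is a rung leaf, D-0061). Cell `hubbard-obs` (MO-S2), seat `hubbard-cov-ndnio2-box-1`
(`prover-hubbard-cov-ndnio2-box-1-g0-0`, g1), captain DECISION D21 «LEAF CAPSTONE» (obs STATUS 2026-08-28 18:48:38Z). Zero compute; one term.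
References: T. Koma, H. Tasaki, J. Stat. Phys. 76 (1994) 745, §1 [KomaTasaki1994]; D. J. Scalapino, S. R. White, S.-C. Zhang, PRB 47 (1993) 7995, §II [ScalapinoWhiteZhang1993].
-/

noncomputable section

namespace Summit.Ventures.CertifiedManyBodySolver.Theorems

open Summit.Ventures.CertifiedManyBodySolver.Observables Summit.Ventures.CertifiedManyBodySolver.Certificates

/-- **THE RUNG LEAF «MOS2-ndnio2-M21» MODULO THE THREE BUNDLE CLAIM NODES (node-free edition):** `NdNiO2M21_StiffnessBoxCeiling` from the segment-A (e0 read j314087), segment-B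
(e1 read j313367) and segment-C (e1 read j313498) P-row nodes, via the route's deciding theorem `closes` and the two «closed modulo nodes» closers. [cite: KomaTasaki1994, §1]
[cite: ScalapinoWhiteZhang1993, §II] -/
theorem ndNiO2M21_StiffnessBoxCeiling_of_bundleNodes_AF
    (hPA : cert_ndBoxE_n477o500_bundleA_om23o50_AF_j314087_wn)
    (hPB : cert_ndBoxE_n477o500_bundleB_om23o50_AF_e1_j313367_wn)
    (hPC : cert_ndBoxE_n477o500_bundleC_om23o50_AF_e1_j313498_wn) :
    Summit.Ventures.CertifiedManyBodySolver.Observables.NdNiO2M21_StiffnessBoxCeiling :=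
  Summit.Ventures.CertifiedManyBodySolver.Theses.CovNdNiO2M21.closes
    (covNdNiO2M21_ResidualLowUSlab_of_bundleNodes_AF hPA hPB hPC) (covNdNiO2M21_ResidualHighUSlab_of_bundleNodes_AF hPA hPB)

end Summit.Ventures.CertifiedManyBodySolver.Theorems

end
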